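/-
Copyright: statement-level skeleton of a published paper (lit-balaban cell, Phase-2 proof seat p32 gen 42). No claims beyond
what the kernel checks below.
-/
import Literature.MathematicalPhysics.QuantumFieldTheory.Balaban1983to89.B3OnePIBridgeOrder

/-!
# B3 — T. Bałaban, *(Higgs)₂,₃ quantum fields in a finite volume. III. Renormalization*, CMP **88** (1983) 411–445
[Balaban1983Higgs3] — p. 416 [PDF 6] (1.21): THE CHAIN DECOMPOSITION OF A CONNECTED TWO-ROOTED GRAPH OF THE MODEL, I —
the separating lines between the two roots, their near legs, and the LEVEL function `v ↦ #{separating lines v lies beyond}`: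
the separating lines sit at the pairwise distinct levels `0, …, m − 1` («the k-th separating line»), every internal line either
keeps the level or is the separating line between two consecutive levels, and every level `0, …, m` is attained

statement-level skeleton of published theorems with citation tags; proofs where landed; nothing here is a claim about
the Yang–Mills mass gap

PDF held: `paper:balaban1983-higgs-2-3-quantum-fields-finite-volume` (journal page = PDF page + 410); p. 415 L28–31 and
p. 416 L13–18 of the text layer (`lit read … --pages 5-7`, files `p0005.txt`/`p0006.txt`) re-read this session; ×2 renders
`run/shared/lean/pub/pub-balaban/b2b-balaban-ref1/pages/1983-cmp88-higgs23-III/1983-cmp88-higgs23-III-p005, p006-x2.png`.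

CITATION HEADER (lean-in-tree rule).  lit-balaban TYPED SKELETON (HOME `run/shared/lean/pub/lit-balaban/`), PHASE 2, seat p32
gen 42 (unit `lit-balaban-p32`; TAKING line HOME/STATUS.md 2026-08-23T10:20:40Z), row **B3.Eq1.19-1.22** of
`HOME/lit-balaban-r15/ROWS-B3.md` (fold owner r15, referee ref-4; head `proved` under the lead g12 HEAD WORD Q25 2026-08-23T08:24:18Z,
reading (P): the bricks of the `B3TwoPointPerturbativeExpansion` programme are OPTIONAL located members, zero head weight).
This file and its sibling `B3OnePIChainPieces` are the ANALYSIS half of the graph side of (1.21): p32 g41's BRICK 2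
`B3Eq121OnePIChains` indexes a connected two-point graph ABSTRACTLY as a chain `List ι` of proper insertions
(`chainAmp = C₀K₁C₀…K_mC₀`) and states the indexing convention «connected two-point graph = chain of 1PI pieces» as NOT derived on
the model; p37 g105's BRICK 3 supplied the model predicates (`B3OnePIGraphs.IsConnected`/`IsOnePI`/`IsProper`), the bridge lemma
(`B3OnePIBridge`: a separating line has one endpoint on each side, the cut leaves two pieces, every other line stays in a side)
and the total order of the separating lines (`B3OnePIBridgeOrder.sides_nested`/`sides_nested_strict`), naming «the pieces between
consecutive separating lines» as not constructed.  HERE that decomposition is DERIVED at vertex level.  Disjoint from p37 g106's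
`B3OnePIDecide` (decidability of the predicates) and from the announced glue constructor `B3OnePIChainGlue` (synthesis direction).
REUSED BY NAME, nothing re-declared: p18's `B3Cor23Concrete.Graph`/`Leg` (`other_symm`), p37's `Adj`/`AdjOff`/`IsConnected`,
`adjOffOf_iff`, `adj_iff`, `sides_of_separates`, `fst_ne_of_separates`, `other_line_same_side`, `sides_nested`.

THE PRINTED TEXT (verbatim).  p. 416: *"The function G^ε has a perturbative expansion of the following structure
G^ε = Σ_{n=0}^∞ C₀^ε[(−δm² + Σ^ε + ∂^{ε*}Σ₁^ε + Σ₁^{ε*}∂^ε + ∂^{ε*}Σ₂^ε∂^ε)C₀^ε]ⁿ, (1.21) where C₀^ε = (−Δ₀^ε + m²)^{−1} and Σ^ε, Σ₁^ε, Σ₂^ε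
are given by amputated, one-particle-irreducible graphs of the expansion of G^ε."*  p. 415: *"Now a graph for us is a collection of
internal lines, external legs, and vertices connected in the usual sense. There is at least one internal line, and every internal
line has a vertex at each endpoint."*  Print states the chain structure of (1.21) without proof (the standard combinatorics of formal
perturbation theory: a connected two-point graph, read from one external leg to the other, is a string of propagator lines `C₀` —
the lines whose removal disconnects the two legs — alternating with the irreducible pieces between them); what is proved here is
that structure, for the graphs of the model.

WHAT IS TYPED / PROVED (definitions with bodies + theorems; no `Prop` fact, no `sorry`; standard axioms).  For `G : Graph n̄`
and two ROOT vertices `i j : Fin G.nV` (for (1.21): the vertices of the two external scalar legs; `i = j` allowed):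
* §1 the cut named by either leg of a line is the same relation (`adjOff_other_eq`);
* §2 `Sep G i j c` (the internal line through the leg `c` SEPARATES `i` from `j`: p37's `¬ ReflTransGen (AdjOff G c) i j`),
  `IsNear G i j c` (moreover the vertex of `c` stays on the side of `i`: the NEAR leg — exactly one per separating line, `Sep.isNear_or`,
  `IsNear.not_isNear_other`, from `sides_of_separates`), the finset `nearLegs G i j` and `numSep G i j = m` (the number of separating
  lines), `beyond G i j v` and the LEVEL `level G i j v = #(beyond G i j v)` = the number of separating lines the vertex `v` lies beyond;
* §3 **`level_left`** (`level i = 0`), **`level_right`** (`level j = m`), `level_le` (`≤ m`), `IsNear.level_lt` (`< m` at a near leg),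
  **`IsNear.level_far`** (across a separating line, near → far, the level rises by EXACTLY one), **`level_eq_of_not_sep`** (across any
  other internal line it is constant), `level_adj` (adjacent vertices differ by at most one), `isNear_of_level_succ` /
  `exists_isNear_of_adj_succ` (a rise by one IS the crossing of a separating line at its near leg);
* §4 **`IsNear.level_ne`** / **`IsNear.eq_of_level_eq`** (distinct separating lines sit at distinct levels: their sides are strictly
  nested, p37's `sides_nested` + `IsNear.not_inSide_of_subset`; so «THE k-th separating line» is well defined),
  **`exists_isNear_level_eq`** (every `k < m` is the level of a near leg — the `m` near legs biject with `{0,…,m−1}`),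
  **`exists_level_eq`** (every level `k ≤ m` is attained: the pieces `V_k = {level = k}` are non-empty), `line_cases`,
  `line_between_consecutive_unique` (no line joins non-consecutive pieces; consecutive pieces are joined by exactly one line).
The sibling `B3OnePIChainPieces` proves that each piece is connected through its own lines and PROPER between its ports.
HONEST SCOPE.  A vertex-level decomposition with its properties; the pieces as `Graph n̄` sub-objects (re-indexed vertices and
legs), the inverse gluing of a chain of graphs into a graph, and any amplitude/kernel map graph ↦ operator are NOT constructed
here (so `B3Eq121OnePIChainsLetters.sigmaSeries_eq_greenSeries_of_equiv` is not instantiated); nothing analytic; roots are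
vertices, the choice «vertices of the two external scalar legs» is the reader's.
-/

namespace Literature.MathematicalPhysics.QuantumFieldTheory.Balaban1983to89.B3OnePIChainDecomposition

open Relation Finset B3Prop1 B3Cor23Concrete B3OnePIGraphs B3OnePIBridge B3OnePIBridgeOrder

variable {nbar : ℕ} {G : Graph nbar}

/-! ## §1 The two legs of an internal line name the same cut -/

/-- kernel: if the line through `c` ends at the leg `c′`, the only leg whose line ends at `c` is `c′`.
[cite: Balaban1983Higgs3, p.415] -/
theorem eq_other_of_other_eq {c c' x : Leg G.kind} (hc : G.other c = some c') (hx : G.other x = some c) : x = c' := by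
  have h := G.other_symm _ _ hx
  rw [hc] at h
  exact (Option.some.inj h).symm

/-- kernel: cutting the line through `c` = cutting the line through its other leg `c′` (one direction).
[cite: Balaban1983Higgs3, (1.21) p.416] -/
theorem adjOff_of_other {c c' : Leg G.kind} (hc : G.other c = some c') {a b : Fin G.nV} (h : AdjOff G c a b) :
    AdjOff G c' a b := by
  have hc' : G.other c' = some c := G.other_symm _ _ hc
  obtain ⟨x, y, hxy, hxc, hyc, hx, hy⟩ := adjOffOf_iff.1 h
  refine adjOffOf_iff.2 ⟨x, y, hxy, ?_, ?_, hx, hy⟩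
  · rintro rfl
    rw [hc'] at hxy
    exact hyc (Option.some.inj hxy).symm
  · rintro rfl
    exact hxc (eq_other_of_other_eq hc' hxy)

/-- kernel: the cut named by either leg of a line is the same relation. [cite: Balaban1983Higgs3, (1.21) p.416] -/
theorem adjOff_other_eq {c c' : Leg G.kind} (hc : G.other c = some c') : AdjOff G c' = AdjOff G c := by
  funext a b
  exact propext ⟨adjOff_of_other (G.other_symm _ _ hc), adjOff_of_other hc⟩

/-! ## §2 Separating lines between two root vertices; near legs; the level function -/

section Roots

variable (G) (i j : Fin G.nV)

/-- `Sep G i j c`: the leg `c` lies on an internal line whose cut SEPARATES the root vertex `i` from the root vertex `j`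
(no path of internal lines from `i` to `j` avoids that line).  For (1.21): `i`, `j` are the vertices carrying the two
external scalar legs of a connected two-point graph, and the separating lines are the propagator lines `C₀` written between
consecutive insertions of the chain `C₀K₁C₀K₂…K_mC₀`. [cite: Balaban1983Higgs3, (1.21) p.416] -/
def Sep (c : Leg G.kind) : Prop :=
  (G.other c).isSome ∧ ¬ ReflTransGen (AdjOff G c) i j

/-- `IsNear G i j c`: `c` is the NEAR leg of a separating line — its own vertex stays joined to `i` after the cut (each
separating line has exactly one near leg, `B3OnePIBridge.sides_of_separates`). [cite: Balaban1983Higgs3, (1.21) p.416] -/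
def IsNear (c : Leg G.kind) : Prop :=
  Sep G i j c ∧ ReflTransGen (AdjOff G c) i c.1

open Classical in
/-- the near legs of the separating lines between `i` and `j` (one per separating line). [cite: Balaban1983Higgs3, (1.21) p.416] -/
noncomputable def nearLegs : Finset (Leg G.kind) :=
  univ.filter (IsNear G i j)

/-- the number of internal lines separating `i` from `j` (= the number `m` of propagators `C₀` strictly inside the chain
`C₀K₁C₀…K_mC₀`, i.e. the number of insertions is `m`… see `level_right`). [cite: Balaban1983Higgs3, (1.21) p.416] -/
noncomputable def numSep : ℕ := (nearLegs G i j).card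

open Classical in
/-- the separating lines the vertex `v` lies BEYOND (seen from `i`): near legs `c` with `v` off the side of `i` after cutting
the line of `c`. [cite: Balaban1983Higgs3, (1.21) p.416] -/
noncomputable def beyond (v : Fin G.nV) : Finset (Leg G.kind) :=
  (nearLegs G i j).filter fun c => ¬ ReflTransGen (AdjOff G c) i v

/-- the LEVEL of a vertex: the number of separating lines it lies beyond, seen from `i` — the index `k` of the piece `V_k`
of the chain `V_0 —ℓ₁— V_1 —ℓ₂— ⋯ —ℓ_m— V_m` containing it. [cite: Balaban1983Higgs3, (1.21) p.416] -/
noncomputable def level (v : Fin G.nV) : ℕ := (beyond G i j v).card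

end Roots

variable {i j : Fin G.nV}

/-- kernel: membership in `nearLegs`. [cite: Balaban1983Higgs3, (1.21) p.416] -/
theorem mem_nearLegs {c : Leg G.kind} : c ∈ nearLegs G i j ↔ IsNear G i j c := by
  classical
  simp [nearLegs]

/-- kernel: membership in `beyond`. [cite: Balaban1983Higgs3, (1.21) p.416] -/
theorem mem_beyond {c : Leg G.kind} {v : Fin G.nV} :
    c ∈ beyond G i j v ↔ IsNear G i j c ∧ ¬ ReflTransGen (AdjOff G c) i v := by
  classical
  simp [beyond, nearLegs]

/-- kernel: `beyond v ⊆ nearLegs`. [cite: Balaban1983Higgs3, (1.21) p.416] -/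
theorem beyond_subset (v : Fin G.nV) : beyond G i j v ⊆ nearLegs G i j := by
  classical
  exact filter_subset _ _

/-- kernel: separation is a property of the LINE — it passes to the other leg. [cite: Balaban1983Higgs3, (1.21) p.416] -/
theorem Sep.of_other {c c' : Leg G.kind} (h : Sep G i j c) (hc : G.other c = some c') : Sep G i j c' := by
  refine ⟨by simp [G.other_symm _ _ hc], ?_⟩
  rw [adjOff_other_eq hc]
  exact h.2

/-- kernel: a separating leg lies on an internal line. [cite: Balaban1983Higgs3, (1.21) p.416] -/
theorem Sep.exists_other {c : Leg G.kind} (h : Sep G i j c) : ∃ c', G.other c = some c' :=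
  Option.isSome_iff_exists.1 h.1

/-- kernel: a near leg separates. [cite: Balaban1983Higgs3, (1.21) p.416] -/
theorem IsNear.sep {c : Leg G.kind} (h : IsNear G i j c) : Sep G i j c := h.1

/-- kernel: the vertex of a near leg is on the side of `i`. [cite: Balaban1983Higgs3, (1.21) p.416] -/
theorem IsNear.inSide {c : Leg G.kind} (h : IsNear G i j c) : ReflTransGen (AdjOff G c) i c.1 := h.2

section Connected

variable (hG : IsConnected G)
include hG

/-- kernel: the far endpoint of a separating line lies OFF the side of `i` and is joined to `j` after the cut.
[cite: Balaban1983Higgs3, (1.21) p.416] -/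
theorem IsNear.far {c c' : Leg G.kind} (h : IsNear G i j c) (hc : G.other c = some c') :
    ¬ ReflTransGen (AdjOff G c) i c'.1 ∧ ReflTransGen (AdjOff G c) c'.1 j := by
  rcases sides_of_separates hG hc h.1.2 with ⟨_, h₂, h₃⟩ | ⟨_, _, h₃⟩
  · exact ⟨h₃, h₂⟩
  · exact absurd h.2 h₃

/-- kernel: a separating line is not a loop. [cite: Balaban1983Higgs3, (1.21) p.416] -/
theorem IsNear.fst_ne {c c' : Leg G.kind} (h : IsNear G i j c) (hc : G.other c = some c') : c.1 ≠ c'.1 :=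
  fst_ne_of_separates hG hc h.1.2

/-- kernel: the other leg of a near leg is not near (one near leg per separating line). [cite: Balaban1983Higgs3, (1.21) p.416] -/
theorem IsNear.not_isNear_other {c c' : Leg G.kind} (h : IsNear G i j c) (hc : G.other c = some c') :
    ¬ IsNear G i j c' := by
  intro h'
  have h2 := h'.2
  rw [adjOff_other_eq hc] at h2
  exact (h.far hG hc).1 h2

/-- kernel: one of the two legs of a separating line is near. [cite: Balaban1983Higgs3, (1.21) p.416] -/
theorem Sep.isNear_or {c c' : Leg G.kind} (h : Sep G i j c) (hc : G.other c = some c') :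
    IsNear G i j c ∨ IsNear G i j c' := by
  rcases sides_of_separates hG hc h.2 with ⟨h₁, _, _⟩ | ⟨h₁, _, _⟩
  · exact Or.inl ⟨h, h₁⟩
  · refine Or.inr ⟨h.of_other hc, ?_⟩
    rw [adjOff_other_eq hc]
    exact h₁

end Connected

/-! ## §3 The level function along the lines of the graph -/

/-- **the root `i` has level 0**. [cite: Balaban1983Higgs3, (1.21) p.416] -/
theorem level_left : level G i j i = 0 := by
  rw [level, card_eq_zero, eq_empty_iff_forall_notMem]
  intro c hc
  exact (mem_beyond.1 hc).2 ReflTransGen.refl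

/-- **the root `j` has level `m`** = the number of separating lines. [cite: Balaban1983Higgs3, (1.21) p.416] -/
theorem level_right : level G i j j = numSep G i j := by
  rw [level, numSep]
  congr 1
  apply Subset.antisymm (beyond_subset j)
  intro c hc
  exact mem_beyond.2 ⟨mem_nearLegs.1 hc, (mem_nearLegs.1 hc).1.2⟩

/-- kernel: every level is at most `m`. [cite: Balaban1983Higgs3, (1.21) p.416] -/
theorem level_le (v : Fin G.nV) : level G i j v ≤ numSep G i j :=
  card_le_card (beyond_subset v)

/-- kernel: the vertex of a near leg has level `< m` (it is not beyond its own line). [cite: Balaban1983Higgs3, (1.21) p.416] -/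
theorem IsNear.level_lt {c : Leg G.kind} (h : IsNear G i j c) : level G i j c.1 < numSep G i j := by
  apply card_lt_card
  refine (ssubset_iff_of_subset (beyond_subset _)).2 ⟨c, mem_nearLegs.2 h, fun hc => ?_⟩
  exact (mem_beyond.1 hc).2 h.2

/-- **a non-separating line keeps the level**: both endpoints of an internal line that does not separate `i` from `j`
have the same level. [cite: Balaban1983Higgs3, (1.21) p.416] -/
theorem level_eq_of_not_sep {x y : Leg G.kind} (hxy : G.other x = some y) (hx : ¬ Sep G i j x) :
    level G i j x.1 = level G i j y.1 := by
  rw [level, level]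
  congr 1
  ext d
  rw [mem_beyond, mem_beyond]
  refine and_congr_right fun hd => not_congr ?_
  obtain ⟨d', hd'⟩ := hd.1.exists_other
  have hxd : x ≠ d := by
    rintro rfl
    exact hx hd.1
  have hxd' : x ≠ d' := by
    rintro rfl
    exact hx (hd.1.of_other hd')
  exact other_line_same_side hd' hxy hxd hxd'

section Connected

variable (hG : IsConnected G)
include hG

/-- **crossing a separating line raises the level by exactly one**: for a near leg `c` with far leg `c′`,
`level c′.1 = level c.1 + 1` (the far endpoint lies beyond the same lines as the near one, and beyond ℓ itself).
[cite: Balaban1983Higgs3, (1.21) p.416] -/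
theorem IsNear.level_far {c c' : Leg G.kind} (h : IsNear G i j c) (hc : G.other c = some c') :
    level G i j c'.1 = level G i j c.1 + 1 := by
  classical
  have hnot : c ∉ beyond G i j c.1 := fun hm => (mem_beyond.1 hm).2 h.2
  rw [level, level, ← card_insert_of_notMem hnot]
  congr 1
  ext d
  rw [mem_insert, mem_beyond, mem_beyond]
  constructor
  · rintro ⟨hd, hdv⟩
    by_cases hdc : d = c
    · exact Or.inl hdc
    · right
      refine ⟨hd, fun hv => hdv ?_⟩
      obtain ⟨d', hd'⟩ := hd.1.exists_other
      have hcd' : c ≠ d' := by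
        rintro rfl
        exact h.not_isNear_other hG (G.other_symm _ _ hd') hd
      exact (other_line_same_side hd' hc (Ne.symm hdc) hcd').1 hv
  · rintro (rfl | ⟨hd, hdv⟩)
    · exact ⟨h, (h.far hG hc).1⟩
    · refine ⟨hd, fun hv => hdv ?_⟩
      obtain ⟨d', hd'⟩ := hd.1.exists_other
      have hdc : d ≠ c := by
        rintro rfl
        exact hdv h.2
      have hcd' : c ≠ d' := by
        rintro rfl
        exact h.not_isNear_other hG (G.other_symm _ _ hd') hd
      exact (other_line_same_side hd' hc hdc.symm hcd').2 hv

/-- kernel: across a separating line one of its legs is near and the level rises by one towards the other.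
[cite: Balaban1983Higgs3, (1.21) p.416] -/
theorem Sep.level_cases {x y : Leg G.kind} (h : Sep G i j x) (hxy : G.other x = some y) :
    (IsNear G i j x ∧ level G i j y.1 = level G i j x.1 + 1) ∨
    (IsNear G i j y ∧ level G i j x.1 = level G i j y.1 + 1) := by
  rcases h.isNear_or hG hxy with hn | hn
  · exact Or.inl ⟨hn, hn.level_far hG hxy⟩
  · exact Or.inr ⟨hn, hn.level_far hG (G.other_symm _ _ hxy)⟩

/-- **adjacent vertices differ in level by at most one**. [cite: Balaban1983Higgs3, (1.21) p.416] -/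
theorem level_adj {a b : Fin G.nV} (h : Adj G a b) :
    level G i j a = level G i j b ∨ level G i j b = level G i j a + 1 ∨ level G i j a = level G i j b + 1 := by
  obtain ⟨x, y, hxy, rfl, rfl⟩ := adj_iff.1 h
  by_cases hx : Sep G i j x
  · rcases hx.level_cases hG hxy with ⟨_, e⟩ | ⟨_, e⟩
    · exact Or.inr (Or.inl e)
    · exact Or.inr (Or.inr e)
  · exact Or.inl (level_eq_of_not_sep hxy hx)

/-- kernel: along an internal line the level rises by at most one. [cite: Balaban1983Higgs3, (1.21) p.416] -/
theorem level_le_succ_of_adj {a b : Fin G.nV} (h : Adj G a b) : level G i j b ≤ level G i j a + 1 := by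
  rcases level_adj (i := i) (j := j) hG h with e | e | e <;> omega

/-- kernel: an internal line across which the level rises by one is a separating line entered at its near leg.
[cite: Balaban1983Higgs3, (1.21) p.416] -/
theorem isNear_of_level_succ {x y : Leg G.kind} (hxy : G.other x = some y)
    (h : level G i j y.1 = level G i j x.1 + 1) : IsNear G i j x := by
  by_cases hx : Sep G i j x
  · rcases hx.level_cases hG hxy with ⟨hn, _⟩ | ⟨_, e⟩
    · exact hn
    · omega
  · have := level_eq_of_not_sep hxy hx
    omega

/-- kernel: an adjacency across which the level rises by one is THE crossing of a separating line: some near leg sits at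
`a` with its far leg at `b`. [cite: Balaban1983Higgs3, (1.21) p.416] -/
theorem exists_isNear_of_adj_succ {a b : Fin G.nV} (h : Adj G a b) (hl : level G i j b = level G i j a + 1) :
    ∃ x y : Leg G.kind, G.other x = some y ∧ IsNear G i j x ∧ x.1 = a ∧ y.1 = b := by
  obtain ⟨x, y, hxy, rfl, rfl⟩ := adj_iff.1 h
  exact ⟨x, y, hxy, isNear_of_level_succ hG hxy hl, rfl, rfl⟩

/-! ## §4 The separating lines sit at pairwise distinct levels `0, …, m − 1` -/

/-- kernel: if the side of `i` w.r.t. the line of the near leg `c` is contained in the side w.r.t. the line of the near leg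
`d ≠ c`, then the vertex of `d` is NOT on the side w.r.t. `c` (else its far endpoint would be, and then it would lie on
its own side). [cite: Balaban1983Higgs3, (1.21) p.416] -/
theorem IsNear.not_inSide_of_subset {c d : Leg G.kind} (hc : IsNear G i j c) (hd : IsNear G i j d) (hcd : c ≠ d)
    (hsub : ∀ v, ReflTransGen (AdjOff G c) i v → ReflTransGen (AdjOff G d) i v) :
    ¬ ReflTransGen (AdjOff G c) i d.1 := by
  intro hv
  obtain ⟨c', hc'⟩ := hc.1.exists_other
  obtain ⟨d', hd'⟩ := hd.1.exists_other
  have hdc' : d ≠ c' := by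
    rintro rfl
    exact hc.not_isNear_other hG hc' hd
  have h1 : ReflTransGen (AdjOff G c) i d'.1 := (other_line_same_side hc' hd' (Ne.symm hcd) hdc').1 hv
  exact (hd.far hG hd').1 (hsub _ h1)

/-- **nested sides give ordered levels**: in the situation of `not_inSide_of_subset`, `level c.1 < level d.1`.
[cite: Balaban1983Higgs3, (1.21) p.416] -/
theorem IsNear.level_lt_of_subset {c d : Leg G.kind} (hc : IsNear G i j c) (hd : IsNear G i j d) (hcd : c ≠ d)
    (hsub : ∀ v, ReflTransGen (AdjOff G c) i v → ReflTransGen (AdjOff G d) i v) :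
    level G i j c.1 < level G i j d.1 := by
  have hdc : ¬ ReflTransGen (AdjOff G c) i d.1 := hc.not_inSide_of_subset hG hd hcd hsub
  apply card_lt_card
  refine (ssubset_iff_of_subset ?_).2 ⟨c, mem_beyond.2 ⟨hc, hdc⟩, fun hm => (mem_beyond.1 hm).2 hc.2⟩
  intro e he
  obtain ⟨hen, hec⟩ := mem_beyond.1 he
  refine mem_beyond.2 ⟨hen, fun hed => ?_⟩
  -- `e ≠ c` (c.1 is on its own side), and the sides of `e` and `c` are nested the other way
  have hec' : e ≠ c := by
    rintro rfl
    exact hec hc.2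
  obtain ⟨c', hc'⟩ := hc.1.exists_other
  obtain ⟨e', he'⟩ := hen.1.exists_other
  have hce' : c ≠ e' := by
    rintro rfl
    exact hen.not_isNear_other hG he' hc
  rcases sides_nested hG he' hc' hec'.symm hce' hen.1.2 hc.1.2 with hs | hs
  · -- side_e ⊆ side_c : then d.1 ∉ side_e
    exact hdc (hs _ hed)
  · -- side_c ⊆ side_e : then c.1 ∈ side_e, contradiction
    exact hec (hs _ hc.2)

/-- **the separating lines sit at pairwise distinct levels**: two distinct near legs have vertices of distinct level
(their sides are strictly nested, `B3OnePIBridgeOrder.sides_nested`). [cite: Balaban1983Higgs3, (1.21) p.416] -/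
theorem IsNear.level_ne {c d : Leg G.kind} (hc : IsNear G i j c) (hd : IsNear G i j d) (hcd : c ≠ d) :
    level G i j c.1 ≠ level G i j d.1 := by
  obtain ⟨c', hc'⟩ := hc.1.exists_other
  obtain ⟨d', hd'⟩ := hd.1.exists_other
  have hdc' : d ≠ c' := by
    rintro rfl
    exact hc.not_isNear_other hG hc' hd
  rcases sides_nested hG hc' hd' hcd.symm hdc' hc.1.2 hd.1.2 with hs | hs
  · exact (hc.level_lt_of_subset hG hd hcd hs).ne
  · exact (hd.level_lt_of_subset hG hc hcd.symm hs).ne'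

/-- **«the k-th separating line»**: a near leg is determined by the level of its vertex. [cite: Balaban1983Higgs3, (1.21) p.416] -/
theorem IsNear.eq_of_level_eq {c d : Leg G.kind} (hc : IsNear G i j c) (hd : IsNear G i j d)
    (h : level G i j c.1 = level G i j d.1) : c = d := by
  by_contra hcd
  exact hc.level_ne hG hd hcd h

/-- **every level `k < m` carries exactly one separating line**: existence of the near leg at level `k` (uniqueness is
`IsNear.eq_of_level_eq`) — the `m` near legs have pairwise distinct levels in `{0, …, m − 1}`. [cite: Balaban1983Higgs3, (1.21) p.416] -/
theorem exists_isNear_level_eq {k : ℕ} (hk : k < numSep G i j) : ∃ c, IsNear G i j c ∧ level G i j c.1 = k := by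
  classical
  set f : Leg G.kind → ℕ := fun c => level G i j c.1 with hf
  have hinj : Set.InjOn f (nearLegs G i j) := fun c hc d hd h =>
    (mem_nearLegs.1 hc).eq_of_level_eq hG (mem_nearLegs.1 hd) h
  have hsub : (nearLegs G i j).image f ⊆ range (numSep G i j) := by
    intro k hk
    obtain ⟨c, hc, rfl⟩ := mem_image.1 hk
    exact mem_range.2 (mem_nearLegs.1 hc).level_lt
  have hcard : ((nearLegs G i j).image f).card = numSep G i j := by
    rw [numSep]
    exact card_image_of_injOn hinj
  have himg : (nearLegs G i j).image f = range (numSep G i j) :=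
    eq_of_subset_of_card_le hsub (by rw [card_range, hcard])
  have hk' : k ∈ (nearLegs G i j).image f := by
    rw [himg]
    exact mem_range.2 hk
  obtain ⟨c, hc, hck⟩ := mem_image.1 hk'
  exact ⟨c, mem_nearLegs.1 hc, hck⟩

/-- **every level `0, …, m` is attained** (the pieces `V_0, …, V_m` of the chain are non-empty): level `k < m` by the vertex
of the `k`-th near leg, level `m` by the root `j`. [cite: Balaban1983Higgs3, (1.21) p.416] -/
theorem exists_level_eq {k : ℕ} (hk : k ≤ numSep G i j) : ∃ v, level G i j v = k := by
  rcases Nat.lt_or_eq_of_le hk with hk | rfl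
  · obtain ⟨c, _, hc⟩ := exists_isNear_level_eq hG hk
    exact ⟨c.1, hc⟩
  · exact ⟨j, level_right⟩

/-- **how an internal line sits in the chain**: it either does not separate (both endpoints in one piece `V_k`), or it is the
separating line between two consecutive pieces, entered at its near leg. [cite: Balaban1983Higgs3, (1.21) p.416] -/
theorem line_cases {x y : Leg G.kind} (hxy : G.other x = some y) :
    (¬ Sep G i j x ∧ level G i j x.1 = level G i j y.1) ∨
    (IsNear G i j x ∧ level G i j y.1 = level G i j x.1 + 1) ∨
    (IsNear G i j y ∧ level G i j x.1 = level G i j y.1 + 1) := by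
  by_cases hx : Sep G i j x
  · exact Or.inr (hx.level_cases hG hxy)
  · exact Or.inl ⟨hx, level_eq_of_not_sep hxy hx⟩

/-- **no line joins non-consecutive pieces, and consecutive pieces are joined by exactly one line**: if an internal line has
endpoints at levels `k` and `k + 1`, it is THE separating line whose near leg sits at level `k` — any two such lines coincide.
[cite: Balaban1983Higgs3, (1.21) p.416] -/
theorem line_between_consecutive_unique {x y x' y' : Leg G.kind} (hxy : G.other x = some y) (hxy' : G.other x' = some y')
    (h : level G i j y.1 = level G i j x.1 + 1) (h' : level G i j y'.1 = level G i j x'.1 + 1)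
    (hk : level G i j x.1 = level G i j x'.1) : x = x' ∧ y = y' := by
  have hn := isNear_of_level_succ hG hxy h
  have hn' := isNear_of_level_succ hG hxy' h'
  have hxx : x = x' := hn.eq_of_level_eq hG hn' hk
  subst hxx
  rw [hxy] at hxy'
  exact ⟨rfl, Option.some.inj hxy'⟩

end Connected

end Literature.MathematicalPhysics.QuantumFieldTheory.Balaban1983to89.B3OnePIChainDecomposition
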